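/-
Copyright: cell `pub-ymgap` (HUMAN RULING D-0062), Track A of `YM-PLAN.md`, DAG node N20 (= NE7b); R134 acceleration seat
`pub-ymgap-dag-n20-c` (strategy s1, generation 8), module 45.  Released under the licence of the surrounding project.
-/
import Summits.QuantumFields.YangMills.Theorems.BalabanUVNodesN20LCSHullSeparationRegime
import HarnessLib

/-!
# YM-DAG node N20 (= NE7b), row s1, module 45: THE ONE-STEP LETTER OF THE REGIME — `R_{k+1} ≤ L^t·R_{k+2}` from one step of the
# coupling flow (print: «in some steps the number R_k decreases by the factor L⁻¹»), and module 43's nesting with that letter DISCHARGED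

Track A of `YM-PLAN.md` (cell `pub-ymgap`, HUMAN RULING D-0062), node **N20** = spine estimate NE7b (`T4WeightBudget.RelWeightBound`, NOT
PRINTED, NOT PROVED).  Seat `pub-ymgap-dag-n20-c` (R134, s1 «the first missing estimate»), generation 8, module 45 (imports module 43
`…N20LCSHullSeparationRegime`).  Kernel theorems only: 0 `def`, 0 `sorry`, standard axioms; COUNT-NEUTRAL.  Real arithmetic over def-R's `RkOfRecord`
((2.5)) and the cell's coupling flow `FlowStepRuns.genSeq` ((0.20) [I]) BY NAME (dag-n12-e's `B15Claim189N0OfRecord` §1 API); it asserts nothing of Bałaban's.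

WHY.  Module 43 §2 (`nesting_of_M_large`) derived module 42's nesting letter from «M much larger than M₂» and ONE displayed letter on the regularity
scales, `R_{k+1} ≤ B·R_{k+2}`.  Print fixes `B`: [Balaban1989LargeFieldI] p. 177 *«in some steps the number R_k decreases by the factor L⁻¹»* — along
the flow (2.6) [III] the scale `R_j = L^{s_j}` ((2.5): the least power of `L` above `(log g_j⁻²)^r`) is non-increasing and drops by at most a bounded
power of `L` per step.  THIS FILE proves that letter from ONE STEP of the flow, in the tree's letters:
* §1 (generic `L ≥ 2`, `r`): `RkOfRecord_le_pow_mul_of_log_pow_le` (`(log g⁻²)^r ≤ L^t·(log g′⁻²)^r ⇒ R(g) ≤ L^t·R(g′)`, minimality of (2.5)),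
  `log_inv_sq_le_two_mul` (`0 < g ≤ g′`, `g′² ≤ ½`, `g′² ≤ 2g²` ⇒ `log g⁻² ≤ 2·log g′⁻²`), ★ `RkOfRecord_le_pow_mul_of_step` (the same three letters and
  `2^r ≤ L^t` ⇒ **`R(g) ≤ L^t·R(g′)`**; `t = r` always works by `Nat.pow_le_pow_left`).
* §2 (the flow of record `genSeq β g₀`, (0.20) [I] ∕ (2.6) [III]): `genSeq_succ_sq_le_two_mul_sq` (`0 ≤ β_j ≤ ½g_j⁻²` ⇒ `g_{j+1}² ≤ 2g_j²`), ★★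
  `RkOfRecord_genSeq_le_pow_mul_succ` (`R(g_{j}) ≤ L^t·R(g_{j+1})` under `0 < g_j`, `0 ≤ β_j ≤ ½g_j⁻²`, `g_{j+1}² ≤ ½`, `2^r ≤ L^t`).
* §3 ★★★ `nesting_of_M_large_of_step` ∕ `nesting_of_M_large_genSeq` — module 43's `nesting_of_M_large` with `B := L^t` DISCHARGED by §1 ∕ §2: the
  separation's numeric side condition now reads **`((r₁+1)·L^t + (r₂+1)·L + 8)·M₂ ≤ 4·M`** plus one flow step of print's kind — «M much larger than M₂».
* §4 `not_nesting_of_M_lt_three_mul` — conversely every numerics with `M < 3·M₂` (in particular EVERY Stage-13 record of the tree, `M = M₂ = 1`) is outside the regime.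

HONEST FRAMING.  Arithmetic; no estimate of Bałaban's.  The LOCALITY letter on `R`, `hreg`, «LCS-j on the hull of window-admissible pins» ((A1c), THE wall),
the reading and the 𝐑-step stay displayed as in modules 40–44; the flow letters `0 ≤ β_j ≤ ½g_j⁻²`, `g_{j+1}² ≤ ½` are the standing small-coupling window of
the series ((2.6): `β₀ > 0 can be chosen arbitrarily small, if g is sufficiently small`).  NE7b NOT PRINTED ∕ NOT PROVED; (α)-instance 0∕1; N20 NOT discharged;
typed 28∕28, discharged count untouched; one finite four-torus at fixed `ε` — NOT ℝ⁴, NOT infinite volume, NOT OS, NOT a mass gap, NOT Clay.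

References (LOCATORS): T. Bałaban, CMP 119 (1988) 243–285 [Balaban1988Convergent] (p. 245, (2.5)–(2.6) p. 255); CMP 122 (1989) 175–202
[Balaban1989LargeFieldI] (p. 177 «R_k decreases by the factor L⁻¹»); CMP 109 (1987) 249–301 [Balaban1987RG1] ((0.20) p. 256).
-/

set_option autoImplicit false

noncomputable section

namespace Summit.QuantumFields.YangMills.BalabanUVNodes.N20LCSHullSeparationScaleStep

open Literature.MathematicalPhysics.QuantumFieldTheory.Balaban1983to89
open Literature.MathematicalPhysics.QuantumFieldTheory.Balaban1983to89.T4Continuum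
open Literature.MathematicalPhysics.QuantumFieldTheory.Balaban1983to89.B14.Eq218Concrete
open Literature.MathematicalPhysics.QuantumFieldTheory.Balaban1983to89.Node00
open Literature.MathematicalPhysics.QuantumFieldTheory.Balaban1983to89.B15Claim189N0OfRecord (log_pow_le_RkOfRecord RkOfRecord_le_pow_of_le)
open Literature.MathematicalPhysics.QuantumFieldTheory.Balaban1983to89.FlowStep (HBeta prefixOf)
open Literature.MathematicalPhysics.QuantumFieldTheory.Balaban1983to89.FlowStepRuns
  (genSeq genSeq_succ solveCoupling solveCoupling_nonpos inv_sq_solveCoupling)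
open Summit.QuantumFields.YangMills.BalabanUVNodes.N20LCSHullSeparationRegime (nesting_of_M_large)

/-! ## §1 Generic: one step of the regularity scale `R(g) = L^{s(g)}` of (2.5) -/

section Generic

variable {L : ℕ}

/-- **MINIMALITY OF (2.5) AGAINST A SCALED BOUND**: if `(log g⁻²)^r ≤ L^t·(log g′⁻²)^r` then `R(g) ≤ L^t·R(g′)` (`R(g′) = L^{s′}` dominates `(log g′⁻²)^r`, so
`L^{t+s′}` dominates `(log g⁻²)^r`, and `R(g)` is the least such power). [cite: Balaban1988Convergent, (2.5) p.255] -/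
theorem RkOfRecord_le_pow_mul_of_log_pow_le (hL : 2 ≤ L) (r t : ℕ) {g g' : ℝ}
    (h : (Real.log (g ^ 2)⁻¹) ^ r ≤ ((L ^ t : ℕ) : ℝ) * (Real.log (g' ^ 2)⁻¹) ^ r) :
    RkOfRecord L r g ≤ L ^ t * RkOfRecord L r g' := by
  obtain ⟨s', hs', hle', -⟩ := isRj_RkOfRecord hL r g'
  have h2 : (Real.log (g ^ 2)⁻¹) ^ r ≤ ((L ^ (t + s') : ℕ) : ℝ) := by
    calc (Real.log (g ^ 2)⁻¹) ^ r ≤ ((L ^ t : ℕ) : ℝ) * (Real.log (g' ^ 2)⁻¹) ^ r := h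
      _ ≤ ((L ^ t : ℕ) : ℝ) * (RkOfRecord L r g' : ℝ) := mul_le_mul_of_nonneg_left (log_pow_le_RkOfRecord hL r g') (by positivity)
      _ = ((L ^ (t + s') : ℕ) : ℝ) := by rw [hs']; push_cast; ring
  calc RkOfRecord L r g ≤ L ^ (t + s') := RkOfRecord_le_pow_of_le hL r g h2
    _ = L ^ t * RkOfRecord L r g' := by rw [hs', pow_add]

/-- **ONE SMALL-COUPLING STEP AT MOST DOUBLES `log g⁻²` BACKWARDS**: `0 < g ≤ g′`, `g′² ≤ ½`, `g′² ≤ 2g²` give `0 ≤ log g⁻² ≤ 2·log g′⁻²` (`g⁻² ≤ 2g′⁻²` and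
`log 2 ≤ log g′⁻²`). [cite: Balaban1988Convergent, (2.6) p.255; Balaban1987RG1, (0.20) p.256] -/
theorem log_inv_sq_le_two_mul {g g' : ℝ} (hg : 0 < g) (hgg' : g ≤ g') (hsmall : g' ^ 2 ≤ 1 / 2) (hstep : g' ^ 2 ≤ 2 * g ^ 2) :
    0 ≤ Real.log (g ^ 2)⁻¹ ∧ Real.log (g ^ 2)⁻¹ ≤ 2 * Real.log (g' ^ 2)⁻¹ := by
  have hg2 : 0 < g ^ 2 := pow_pos hg 2
  have hg'2 : 0 < g' ^ 2 := pow_pos (lt_of_lt_of_le hg hgg') 2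
  have hle1 : g ^ 2 ≤ 1 := by nlinarith
  have h2 : (2 : ℝ) ≤ (g' ^ 2)⁻¹ := by
    rw [le_inv_comm₀ (by norm_num) hg'2]; linarith
  have hlog2 : Real.log 2 ≤ Real.log (g' ^ 2)⁻¹ := Real.log_le_log (by norm_num) h2
  have hx : Real.log (g ^ 2)⁻¹ ≤ Real.log 2 + Real.log (g' ^ 2)⁻¹ := by
    rw [← Real.log_mul (by norm_num) (ne_of_gt (inv_pos.2 hg'2))]
    refine Real.log_le_log (inv_pos.2 hg2) ?_
    rw [inv_le_comm₀ hg2 (by positivity), mul_inv, inv_inv]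
    nlinarith
  exact ⟨Real.log_nonneg ((one_le_inv_iff₀.2 ⟨hg2, hle1⟩)), by linarith⟩

/-- ★ **ONE STEP OF THE FLOW COSTS AT MOST THE FACTOR `L^t` IN THE REGULARITY SCALE** (`2^r ≤ L^t`): `0 < g ≤ g′`, `g′² ≤ ½`, `g′² ≤ 2g²` give
**`R(g) ≤ L^t·R(g′)`** — print's *«in some steps the number R_k decreases by the factor L⁻¹»* in the record's letters (`R` is also non-increasing along the
flow: dag-n12-e's `RkOfRecord_anti`; the exponent `t := r` always serves, `Nat.pow_le_pow_left`). [cite: Balaban1989LargeFieldI, p.177; Balaban1988Convergent, (2.5)–(2.6) p.255] -/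
theorem RkOfRecord_le_pow_mul_of_step (hL : 2 ≤ L) {r t : ℕ} (ht : 2 ^ r ≤ L ^ t) {g g' : ℝ} (hg : 0 < g) (hgg' : g ≤ g')
    (hsmall : g' ^ 2 ≤ 1 / 2) (hstep : g' ^ 2 ≤ 2 * g ^ 2) : RkOfRecord L r g ≤ L ^ t * RkOfRecord L r g' := by
  obtain ⟨hx0, hx⟩ := log_inv_sq_le_two_mul hg hgg' hsmall hstep
  refine RkOfRecord_le_pow_mul_of_log_pow_le hL r t ?_
  have hx'0 : 0 ≤ Real.log (g' ^ 2)⁻¹ := by linarith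
  calc (Real.log (g ^ 2)⁻¹) ^ r ≤ (2 * Real.log (g' ^ 2)⁻¹) ^ r := pow_le_pow_left₀ hx0 hx r
    _ = (2 : ℝ) ^ r * (Real.log (g' ^ 2)⁻¹) ^ r := mul_pow _ _ _
    _ ≤ ((L ^ t : ℕ) : ℝ) * (Real.log (g' ^ 2)⁻¹) ^ r := by
        refine mul_le_mul_of_nonneg_right ?_ (pow_nonneg hx'0 r)
        exact_mod_cast ht

end Generic

/-! ## §2 Along the flow of record `genSeq β g₀` ((0.20) [I]): one step with `0 ≤ β_j ≤ ½g_j⁻²` -/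

section Flow

/-- **ONE STEP OF (0.20) WITH `0 ≤ β_j ≤ ½g_j⁻²` AT MOST DOUBLES `g²`**: `g_{j+1}⁻² = g_j⁻² − β_j ≥ ½g_j⁻²`, so `g_{j+1}² ≤ 2g_j²` (and `g_j ≤ g_{j+1}`, dag-n12-e's
`genSeq_le_succ_of_beta_nonneg`). [cite: Balaban1987RG1, (0.20) p.256; Balaban1988Convergent, (2.6) p.255] -/
theorem genSeq_succ_sq_le_two_mul_sq (β : HBeta) (g0 : ℝ) {j : ℕ} (hgj : 0 < genSeq β g0 j)
    (hβ : β j (prefixOf (genSeq β g0) j) ≤ 1 / (2 * (genSeq β g0 j) ^ 2)) :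
    (genSeq β g0 (j + 1)) ^ 2 ≤ 2 * (genSeq β g0 j) ^ 2 := by
  rw [genSeq_succ]
  set y := 1 / (genSeq β g0 j) ^ 2 - β j (prefixOf (genSeq β g0) j) with hy
  have hg2 : 0 < (genSeq β g0 j) ^ 2 := pow_pos hgj 2
  have hylb : 1 / (2 * (genSeq β g0 j) ^ 2) ≤ y := by
    rw [hy]
    have : 1 / (genSeq β g0 j) ^ 2 = 1 / (2 * (genSeq β g0 j) ^ 2) + 1 / (2 * (genSeq β g0 j) ^ 2) := by
      field_simp; ring
    linarith
  have hy0 : 0 < y := lt_of_lt_of_le (by positivity) hylb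
  have hs : 0 < solveCoupling y := FlowStepRuns.solveCoupling_pos hy0
  have hsq : 1 / (solveCoupling y) ^ 2 = y := inv_sq_solveCoupling hy0
  -- `1/(2g²) ≤ 1/s²` with both squares positive gives `s² ≤ 2g²`
  have h1 : 1 / (2 * (genSeq β g0 j) ^ 2) ≤ 1 / (solveCoupling y) ^ 2 := by rw [hsq]; exact hylb
  exact (one_div_le_one_div (by positivity : (0 : ℝ) < 2 * (genSeq β g0 j) ^ 2) (pow_pos hs 2)).1 h1

/-- ★★ **THE ONE-STEP LETTER ALONG THE FLOW OF RECORD**: for `L ≥ 2`, `2^r ≤ L^t`, and a step `j → j+1` of `genSeq β g₀` with `0 < g_j`, `0 ≤ β_j ≤ ½g_j⁻²` and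
`g_{j+1}² ≤ ½`: **`R(g_j) ≤ L^t·R(g_{j+1})`**. [cite: Balaban1989LargeFieldI, p.177; Balaban1988Convergent, (2.5)–(2.6) p.255; Balaban1987RG1, (0.20) p.256] -/
theorem RkOfRecord_genSeq_le_pow_mul_succ {L : ℕ} (hL : 2 ≤ L) {r t : ℕ} (ht : 2 ^ r ≤ L ^ t) (β : HBeta) (g0 : ℝ) {j : ℕ}
    (hgj : 0 < genSeq β g0 j) (hβ0 : 0 ≤ β j (prefixOf (genSeq β g0) j)) (hβ : β j (prefixOf (genSeq β g0) j) ≤ 1 / (2 * (genSeq β g0 j) ^ 2))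
    (hsmall : (genSeq β g0 (j + 1)) ^ 2 ≤ 1 / 2) :
    RkOfRecord L r (genSeq β g0 j) ≤ L ^ t * RkOfRecord L r (genSeq β g0 (j + 1)) := by
  have hstep := genSeq_succ_sq_le_two_mul_sq β g0 hgj hβ
  have hpos : 0 < genSeq β g0 (j + 1) := by
    rw [genSeq_succ]
    refine FlowStepRuns.solveCoupling_pos (lt_of_lt_of_le (by positivity : (0 : ℝ) < 1 / (2 * (genSeq β g0 j) ^ 2)) ?_)
    have : 1 / (genSeq β g0 j) ^ 2 = 1 / (2 * (genSeq β g0 j) ^ 2) + 1 / (2 * (genSeq β g0 j) ^ 2) := by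
      field_simp; ring
    linarith
  have hmono := B15Claim189N0OfRecord.genSeq_le_succ_of_beta_nonneg β g0 hgj hpos hβ0
  exact RkOfRecord_le_pow_mul_of_step hL ht hgj hmono hsmall hstep

end Flow

/-! ## §3 Module 43's nesting with the one-step letter discharged -/

section Nesting

variable (F : T4Family) (ν : Stage7Numerics) (M : ℕ) (p : B12.RunParams) (g : ℕ → ℝ)

/-- ★★★ **MODULE 42's NESTING LETTER FROM «M MUCH LARGER THAN M₂» AND ONE FLOW STEP** (module 43's `nesting_of_M_large` with `B := L^t` discharged by §1): if
`1 ≤ M₂`, `2^r ≤ L^t` (`r` = the exponent of (2.5)), the couplings of the steps `k+1 → k+2` satisfy `0 < g_{k+1} ≤ g_{k+2}`, `g_{k+2}² ≤ ½`, `g_{k+2}² ≤ 2g_{k+1}²`,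
the box radius is `ρ ≤ 8L`, and **`((r₁+1)·L^t + (r₂+1)·L + 8)·M₂ ≤ 4·M`**, then
`(r₁+1)·sideχ k + L^{k+1}·ρ + (r₂+1)·sideχ (k+1) ≤ 4·sideD (k+1) + 2`. [cite: Balaban1988Convergent, p.245, (2.5)–(2.6) p.255; Balaban1989LargeFieldI, p.177] -/
theorem nesting_of_M_large_of_step {k r₁ r₂ ρ t : ℕ} (hM₂ : 1 ≤ ν.M₂) (ht : 2 ^ ν.r ≤ (F.P p.K).L ^ t)
    (hg : 0 < g (k + 1)) (hgg' : g (k + 1) ≤ g (k + 2)) (hsmall : g (k + 2) ^ 2 ≤ 1 / 2) (hstep : g (k + 2) ^ 2 ≤ 2 * g (k + 1) ^ 2)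
    (hρ : ρ ≤ 8 * (F.P p.K).L) (hM : ((r₁ + 1) * (F.P p.K).L ^ t + (r₂ + 1) * (F.P p.K).L + 8) * ν.M₂ ≤ 4 * M) :
    (r₁ + 1) * sideχ F ν p g k + (F.P p.K).L ^ (k + 1) * ρ + (r₂ + 1) * sideχ F ν p g (k + 1) ≤ 4 * sideD F ν M p g (k + 1) + 2 :=
  nesting_of_M_large F ν M p g hM₂ (RkOfRecord_le_pow_mul_of_step (F.P p.K).hL.2 ht hg hgg' hsmall hstep) hρ hM

/-- ★★★ **… ALONG THE FLOW OF RECORD** `g := genSeq β g₀`: one step `k+1 → k+2` with `0 < g_{k+1}`, `0 ≤ β_{k+1} ≤ ½g_{k+1}⁻²`, `g_{k+2}² ≤ ½`, `2^r ≤ L^t`, `ρ ≤ 8L` and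
`((r₁+1)·L^t + (r₂+1)·L + 8)·M₂ ≤ 4·M` give module 42's nesting letter at `k`. [cite: Balaban1988Convergent, p.245, (2.5)–(2.6) p.255; Balaban1987RG1, (0.20) p.256; Balaban1989LargeFieldI, p.177] -/
theorem nesting_of_M_large_genSeq (β : HBeta) (g0 : ℝ) {k r₁ r₂ ρ t : ℕ} (hM₂ : 1 ≤ ν.M₂) (ht : 2 ^ ν.r ≤ (F.P p.K).L ^ t)
    (hg : 0 < genSeq β g0 (k + 1)) (hβ0 : 0 ≤ β (k + 1) (prefixOf (genSeq β g0) (k + 1)))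
    (hβ : β (k + 1) (prefixOf (genSeq β g0) (k + 1)) ≤ 1 / (2 * (genSeq β g0 (k + 1)) ^ 2))
    (hsmall : (genSeq β g0 (k + 2)) ^ 2 ≤ 1 / 2) (hρ : ρ ≤ 8 * (F.P p.K).L)
    (hM : ((r₁ + 1) * (F.P p.K).L ^ t + (r₂ + 1) * (F.P p.K).L + 8) * ν.M₂ ≤ 4 * M) :
    (r₁ + 1) * sideχ F ν p (genSeq β g0) k + (F.P p.K).L ^ (k + 1) * ρ + (r₂ + 1) * sideχ F ν p (genSeq β g0) (k + 1) ≤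
      4 * sideD F ν M p (genSeq β g0) (k + 1) + 2 :=
  nesting_of_M_large F ν M p (genSeq β g0) hM₂ (RkOfRecord_genSeq_le_pow_mul_succ (F.P p.K).hL.2 ht β g0 hg hβ0 hβ hsmall) hρ hM

end Nesting

/-! ## §4 The regime, continued: every numerics with `M < 3·M₂` is outside it (all Stage-13 records of the tree carry `M = M₂ = 1`) -/

section Records

variable (F : T4Family) (ν : Stage7Numerics) (M : ℕ) (p : B12.RunParams) (g : ℕ → ℝ)

/-- **NUMERICS WITH `M < 3·M₂` ARE OUTSIDE THE SEPARATION's REGIME** (module 43's `not_nesting_of_lt` with `4·M < 12·M₂ ≤ (r₂+1)·L·M₂`, `L > 11`): in particular EVERY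
Stage-13 record of the tree — all of them carry def-R's displayed defaults `towerNumericsOfRecord₁₂.M = 1` and `M₂ = 1` (`numerics7OfRecord₁₂`, `numerics7OfFamily`,
`numerics7OfThm1∕C∕CC1`) — module 43's `not_nesting_at_record_defaults` being the named instance.  Print's regime is `M ≫ M₂` ([Balaban1988Convergent] p. 245).
[cite: Balaban1988Convergent, p.245] -/
theorem not_nesting_of_M_lt_three_mul {k r₁ r₂ ρ : ℕ} (hM : M < 3 * ν.M₂) :
    ¬ ((r₁ + 1) * sideχ F ν p g k + (F.P p.K).L ^ (k + 1) * ρ + (r₂ + 1) * sideχ F ν p g (k + 1) ≤ 4 * sideD F ν M p g (k + 1) + 2) := by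
  refine N20LCSHullSeparationRegime.not_nesting_of_lt F ν M p g ?_
  have hL : 11 < (F.P p.K).L := by rw [T4Family.P_L]; exact F.hL11
  calc 4 * M < 12 * ν.M₂ := by omega
    _ ≤ (r₂ + 1) * (F.P p.K).L * ν.M₂ := by
        have h1 : 12 ≤ (r₂ + 1) * (F.P p.K).L := by nlinarith
        exact Nat.mul_le_mul_right _ h1

end Records

/-! ## §5 (v1.1, generation 20) SIGN-FREE TWINS of §1–§3 — the one-step letter from the WINDOW and the CEILING side alone (no `0 ≤ β_j`)

PORT of cell `ym-nodeO-ideate` lens P3 (generation 61) HOME evidence n°110 `SignLeafConsumersOutsideDoors-P3g61.lean` §5 (sha256 31a2f435…,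
pub-ymgap bus 2026-08-28T20:11:01Z: *«module 45's `hβ0` is spurious — sign-free twin in §5, yours to port or ignore»*), by invitation.  §1's
`log_inv_sq_le_two_mul` used its letter `g ≤ g′` — which §2 fed from the SIGN `0 ≤ β_j` through dag-n12-e's `genSeq_le_succ_of_beta_nonneg` — only to get
`0 < g′` and `g² ≤ 1`; both are standing WINDOW letters (`0 < g_{j+1}`, `g_j ≤ 1`).  So the one-step letter `R(g_j) ≤ L^t·R(g_{j+1})` and module 43's nesting
along the flow of record hold under `0 < g_j ≤ 1`, `β_j ≤ ½g_j⁻²` (the CEILING side of the flow window) and `g_{j+1}² ≤ ½` — a DIVE (`β_j < 0`, `g_{j+1} < g_j`)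
satisfies `g_{j+1}² ≤ 2g_j²` trivially.  Consequence for the DAG's accounting (P3's reading, now in tree): N20's regime-step letter does NOT read the β-sign
leaf.  Decls 1–9 above are byte-identical (append-only); the proofs below are §1–§3's with the two hypotheses exchanged. -/

section SignFree

variable {L : ℕ}

/-- **ONE SMALL-COUPLING STEP AT MOST DOUBLES `log g⁻²` BACKWARDS — SIGN-FREE** (twin of `log_inv_sq_le_two_mul`): `0 < g ≤ 1`, `0 < g′`, `g′² ≤ ½`,
`g′² ≤ 2g²` give `0 ≤ log g⁻² ≤ 2·log g′⁻²` (no `g ≤ g′`).  Ported from P3 g61's `log_inv_sq_le_two_mul_signFree` (HOME evidence n°110 §5).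
[cite: Balaban1988Convergent, (2.6) p.255; Balaban1987RG1, (0.20) p.256] -/
theorem log_inv_sq_le_two_mul_signFree {g g' : ℝ} (hg : 0 < g) (hg1 : g ≤ 1) (hg' : 0 < g') (hsmall : g' ^ 2 ≤ 1 / 2)
    (hstep : g' ^ 2 ≤ 2 * g ^ 2) :
    0 ≤ Real.log (g ^ 2)⁻¹ ∧ Real.log (g ^ 2)⁻¹ ≤ 2 * Real.log (g' ^ 2)⁻¹ := by
  have hg2 : 0 < g ^ 2 := pow_pos hg 2
  have hg'2 : 0 < g' ^ 2 := pow_pos hg' 2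
  have hle1 : g ^ 2 ≤ 1 := by nlinarith
  have h2 : (2 : ℝ) ≤ (g' ^ 2)⁻¹ := by
    rw [le_inv_comm₀ (by norm_num) hg'2]; linarith
  have hlog2 : Real.log 2 ≤ Real.log (g' ^ 2)⁻¹ := Real.log_le_log (by norm_num) h2
  have hx : Real.log (g ^ 2)⁻¹ ≤ Real.log 2 + Real.log (g' ^ 2)⁻¹ := by
    rw [← Real.log_mul (by norm_num) (ne_of_gt (inv_pos.2 hg'2))]
    refine Real.log_le_log (inv_pos.2 hg2) ?_
    rw [inv_le_comm₀ hg2 (by positivity), mul_inv, inv_inv]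
    nlinarith
  exact ⟨Real.log_nonneg ((one_le_inv_iff₀.2 ⟨hg2, hle1⟩)), by linarith⟩

/-- ★ **`R(g) ≤ L^t·R(g′)` — SIGN-FREE** (twin of `RkOfRecord_le_pow_mul_of_step`): `2^r ≤ L^t`, `0 < g ≤ 1`, `0 < g′`, `g′² ≤ ½`, `g′² ≤ 2g²`.
Ported from P3 g61's `RkOfRecord_le_pow_mul_of_step_signFree`. [cite: Balaban1989LargeFieldI, p.177; Balaban1988Convergent, (2.5)–(2.6) p.255] -/
theorem RkOfRecord_le_pow_mul_of_step_signFree (hL : 2 ≤ L) {r t : ℕ} (ht : 2 ^ r ≤ L ^ t) {g g' : ℝ} (hg : 0 < g) (hg1 : g ≤ 1)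
    (hg' : 0 < g') (hsmall : g' ^ 2 ≤ 1 / 2) (hstep : g' ^ 2 ≤ 2 * g ^ 2) :
    RkOfRecord L r g ≤ L ^ t * RkOfRecord L r g' := by
  obtain ⟨hx0, hx⟩ := log_inv_sq_le_two_mul_signFree hg hg1 hg' hsmall hstep
  refine RkOfRecord_le_pow_mul_of_log_pow_le hL r t ?_
  have hx'0 : 0 ≤ Real.log (g' ^ 2)⁻¹ := by linarith
  calc (Real.log (g ^ 2)⁻¹) ^ r ≤ (2 * Real.log (g' ^ 2)⁻¹) ^ r := pow_le_pow_left₀ hx0 hx r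
    _ = (2 : ℝ) ^ r * (Real.log (g' ^ 2)⁻¹) ^ r := mul_pow _ _ _
    _ ≤ ((L ^ t : ℕ) : ℝ) * (Real.log (g' ^ 2)⁻¹) ^ r := by
        refine mul_le_mul_of_nonneg_right ?_ (pow_nonneg hx'0 r)
        exact_mod_cast ht

/-- ★★ **THE ONE-STEP LETTER ALONG THE FLOW OF RECORD — SIGN-FREE** (twin of `RkOfRecord_genSeq_le_pow_mul_succ`): for `L ≥ 2`, `2^r ≤ L^t`, a step
`j → j+1` of `genSeq β g₀` with `0 < g_j ≤ 1`, `β_j ≤ ½g_j⁻²` (ceiling side only — NO `0 ≤ β_j`) and `g_{j+1}² ≤ ½`: **`R(g_j) ≤ L^t·R(g_{j+1})`**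
(§2's `genSeq_succ_sq_le_two_mul_sq` is already sign-free).  Ported from P3 g61's `RkOfRecord_genSeq_le_pow_mul_succ_signFree`.
[cite: Balaban1989LargeFieldI, p.177; Balaban1988Convergent, (2.5)–(2.6) p.255; Balaban1987RG1, (0.20) p.256] -/
theorem RkOfRecord_genSeq_le_pow_mul_succ_signFree (hL : 2 ≤ L) {r t : ℕ} (ht : 2 ^ r ≤ L ^ t) (β : HBeta) (g0 : ℝ) {j : ℕ}
    (hgj : 0 < genSeq β g0 j) (hgj1 : genSeq β g0 j ≤ 1)
    (hβ : β j (prefixOf (genSeq β g0) j) ≤ 1 / (2 * (genSeq β g0 j) ^ 2)) (hsmall : (genSeq β g0 (j + 1)) ^ 2 ≤ 1 / 2) :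
    RkOfRecord L r (genSeq β g0 j) ≤ L ^ t * RkOfRecord L r (genSeq β g0 (j + 1)) := by
  have hstep := genSeq_succ_sq_le_two_mul_sq β g0 hgj hβ
  have hpos : 0 < genSeq β g0 (j + 1) := by
    rw [genSeq_succ]
    refine FlowStepRuns.solveCoupling_pos (lt_of_lt_of_le (by positivity : (0 : ℝ) < 1 / (2 * (genSeq β g0 j) ^ 2)) ?_)
    have : 1 / (genSeq β g0 j) ^ 2 = 1 / (2 * (genSeq β g0 j) ^ 2) + 1 / (2 * (genSeq β g0 j) ^ 2) := by
      field_simp; ring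
    linarith
  exact RkOfRecord_le_pow_mul_of_step_signFree hL ht hgj hgj1 hpos hsmall hstep

end SignFree

section NestingSignFree

variable (F : T4Family) (ν : Stage7Numerics) (M : ℕ) (p : B12.RunParams) (g : ℕ → ℝ)

/-- ★★★ **MODULE 42's NESTING LETTER FROM «M MUCH LARGER THAN M₂» AND ONE FLOW STEP — SIGN-FREE** (twin of `nesting_of_M_large_of_step`; module 43's
`nesting_of_M_large` BY NAME with `B := L^t`): `1 ≤ M₂`, `2^r ≤ L^t`, couplings `0 < g_{k+1} ≤ 1`, `0 < g_{k+2}`, `g_{k+2}² ≤ ½`, `g_{k+2}² ≤ 2g_{k+1}²`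
(no `g_{k+1} ≤ g_{k+2}`), `ρ ≤ 8L`, and **`((r₁+1)·L^t + (r₂+1)·L + 8)·M₂ ≤ 4·M`** give
`(r₁+1)·sideχ k + L^{k+1}·ρ + (r₂+1)·sideχ (k+1) ≤ 4·sideD (k+1) + 2`. [cite: Balaban1988Convergent, p.245, (2.5)–(2.6) p.255; Balaban1989LargeFieldI, p.177] -/
theorem nesting_of_M_large_of_step_signFree {k r₁ r₂ ρ t : ℕ} (hM₂ : 1 ≤ ν.M₂) (ht : 2 ^ ν.r ≤ (F.P p.K).L ^ t)
    (hg : 0 < g (k + 1)) (hg1 : g (k + 1) ≤ 1) (hg' : 0 < g (k + 2)) (hsmall : g (k + 2) ^ 2 ≤ 1 / 2)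
    (hstep : g (k + 2) ^ 2 ≤ 2 * g (k + 1) ^ 2) (hρ : ρ ≤ 8 * (F.P p.K).L)
    (hM : ((r₁ + 1) * (F.P p.K).L ^ t + (r₂ + 1) * (F.P p.K).L + 8) * ν.M₂ ≤ 4 * M) :
    (r₁ + 1) * sideχ F ν p g k + (F.P p.K).L ^ (k + 1) * ρ + (r₂ + 1) * sideχ F ν p g (k + 1) ≤ 4 * sideD F ν M p g (k + 1) + 2 :=
  nesting_of_M_large F ν M p g hM₂ (RkOfRecord_le_pow_mul_of_step_signFree (F.P p.K).hL.2 ht hg hg1 hg' hsmall hstep) hρ hM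

/-- ★★★ **… ALONG THE FLOW OF RECORD — SIGN-FREE** (twin of `nesting_of_M_large_genSeq`, `g := genSeq β g₀`): one step `k+1 → k+2` with `0 < g_{k+1} ≤ 1`,
`β_{k+1} ≤ ½g_{k+1}⁻²` (ceiling side only — NO `0 ≤ β_{k+1}`), `g_{k+2}² ≤ ½`, `2^r ≤ L^t`, `ρ ≤ 8L` and `((r₁+1)·L^t + (r₂+1)·L + 8)·M₂ ≤ 4·M` give module 42's
nesting letter at `k`: N20's regime-step letter reads the WINDOW and the CEILING side of the flow, not the β-sign leaf.  Ported from P3 g61's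
`nesting_of_M_large_genSeq_signFree` (HOME evidence n°110 §5). [cite: Balaban1988Convergent, p.245, (2.5)–(2.6) p.255; Balaban1987RG1, (0.20) p.256; Balaban1989LargeFieldI, p.177] -/
theorem nesting_of_M_large_genSeq_signFree (β : HBeta) (g0 : ℝ) {k r₁ r₂ ρ t : ℕ} (hM₂ : 1 ≤ ν.M₂) (ht : 2 ^ ν.r ≤ (F.P p.K).L ^ t)
    (hg : 0 < genSeq β g0 (k + 1)) (hg1 : genSeq β g0 (k + 1) ≤ 1)
    (hβ : β (k + 1) (prefixOf (genSeq β g0) (k + 1)) ≤ 1 / (2 * (genSeq β g0 (k + 1)) ^ 2))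
    (hsmall : (genSeq β g0 (k + 2)) ^ 2 ≤ 1 / 2) (hρ : ρ ≤ 8 * (F.P p.K).L)
    (hM : ((r₁ + 1) * (F.P p.K).L ^ t + (r₂ + 1) * (F.P p.K).L + 8) * ν.M₂ ≤ 4 * M) :
    (r₁ + 1) * sideχ F ν p (genSeq β g0) k + (F.P p.K).L ^ (k + 1) * ρ + (r₂ + 1) * sideχ F ν p (genSeq β g0) (k + 1) ≤
      4 * sideD F ν M p (genSeq β g0) (k + 1) + 2 :=
  nesting_of_M_large F ν M p (genSeq β g0) hM₂
    (RkOfRecord_genSeq_le_pow_mul_succ_signFree (F.P p.K).hL.2 ht β g0 hg hg1 hβ hsmall) hρ hM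

end NestingSignFree

end Summit.QuantumFields.YangMills.BalabanUVNodes.N20LCSHullSeparationScaleStep

end
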